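import Summits.Ventures.Crystal3D.Theorems.StickyWulffConstantPolycrystalWulffBoundMinkowskiPackage
import Summits.Ventures.Crystal3D.Theorems.StickyWulffConstantPolycrystalWulffBoundExteriorCrossSums

/-!
# `PolycrystalWulffBound`, rung `rung_basalLamellar` — step 2h: the arrangement package of a
# polyhedral TEXTURE of `ℝ³` (line `PolyDensity`, crux `stmt-Ventures-19482`)

Route `StickyWulffConstant` of the venture `Summits/Ventures/Crystal3D`, second prover lane (poly-p2,
gen 3).  Euclidean instantiation of the generic `exists_minkowski_package`: for pairwise disjoint
polyhedral grains `G_f` of finite volume (raw `H`-pieces, possibly degenerate) and a margin `M ≥ 0`,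
normalise the constraints, add a bounding box `box a b` containing the `M`-neighbourhood of the texture,
and return (`exists_texture_package`) the unit constraint set `𝓗`, the box, the cells and the package
data with all properties phrased in terms of the grains `G_f` and the box (no sign vectors).
WHAT THIS IS NOT: any measure estimate; nothing on the crux.
-/

noncomputable section

namespace Summit.Ventures.Crystal3D.Theorems

open MeasureTheory Set
open scoped RealInnerProductSpace ENNReal Pointwise
open Summit.Ventures.Crystal3D.Cruxes.TextureLiminf.TexShadow

/-- **The arrangement package of a polyhedral texture.**  See the module docstring. -/
theorem exists_texture_package {n : ℕ} (hn : 0 < n) (G : Fin n → Set E3)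
    (hPoly : ∀ f, ∃ (k : ℕ) (H : Fin k → Finset (E3 × ℝ)), G f = ⋃ i, polytope (H i))
    (hvol : ∀ f, volume (G f) < ⊤) (hdisjG : ∀ f g, f ≠ g → Disjoint (G f) (G g))
    {M : ℝ} (hM : 0 ≤ M) :
    ∃ (𝓗 : Finset (E3 × ℝ)) (a b : E3) (k : ℕ) (H : Fin k → Finset (E3 × ℝ)) (ν : Fin k → Fin k → E3)
      (S : Fin n → Finset (Fin k)) (gr : Fin k → Fin n) (Adj : Finset (Fin k × Fin k))
      (q₀ : Fin k × Fin k → E3 × ℝ),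
      (∀ p ∈ 𝓗, ‖p.1‖ = 1) ∧ (∀ t, a t < b t) ∧
      (∀ x ∈ (⋃ f, G f), ∀ y : E3, ‖y‖ ≤ M → x + y ∈ Rungs.box a b) ∧
      closure (⋃ f, G f) ⊆ Rungs.box a b ∧
      (∀ j, (polytope (H j)).Nonempty) ∧
      (∀ j, Bornology.IsBounded (polytope (H j))) ∧
      (∀ j, ∀ q ∈ H j, ‖q.1‖ = 1) ∧
      (∀ j, ∀ q ∈ H j, ∀ q' ∈ H j, q ≠ q' → {x : E3 | ⟪q.1, x⟫ = q.2} ≠ {x : E3 | ⟪q'.1, x⟫ = q'.2}) ∧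
      (∀ j j', j ≠ j' → Disjoint (polytope (H j)) (polytope (H j'))) ∧
      (∀ i j, ν j i = -ν i j) ∧
      (∀ j j', j ≠ j' → ‖ν j j'‖ = 1 ∧ ∃ b' : ℝ,
        closure (polytope (H j)) ∩ closure (polytope (H j')) ⊆ {x : E3 | ⟪ν j j', x⟫ = b'}) ∧
      (∀ j, polytope (H j) ⊆ Rungs.box a b) ∧
      (Rungs.box a b =ᵐ[volume] ⋃ j, polytope (H j)) ∧
      (∀ f, ∀ j ∈ S f, polytope (H j) ⊆ G f) ∧
      (∀ f (x : E3), (∀ p ∈ 𝓗, ⟪p.1, x⟫ ≠ p.2) → x ∈ G f → ∃ j ∈ S f, x ∈ polytope (H j)) ∧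
      (∀ f, ∀ j ∈ S f, gr j = f) ∧
      (∀ f g, f ≠ g → Disjoint (S f) (S g)) ∧
      (∀ t ∈ Adj, t.1 ∈ S (gr t.1) ∧ (∀ g, t.2 ∉ S g) ∧ q₀ t ∈ H t.2 ∧
        closure (polytope (H t.1)) ∩ closure (polytope (H t.2)) =
          closure (polytope (H t.2)) ∩ {x : E3 | ⟪(q₀ t).1, x⟫ = (q₀ t).2} ∧
        (ν t.1 t.2 = (q₀ t).1 ∨ ν t.1 t.2 = -(q₀ t).1)) ∧
      (∀ f, ∀ a' ∈ S f, ∀ b', (∀ g, b' ∉ S g) → (a', b') ∉ Adj →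
        ∃ p ∈ 𝓗, ∃ p' ∈ 𝓗, {x : E3 | ⟪p.1, x⟫ = p.2} ≠ {x : E3 | ⟪p'.1, x⟫ = p'.2} ∧
          closure (polytope (H a')) ∩ closure (polytope (H b')) ⊆
            {x : E3 | ⟪p.1, x⟫ = p.2} ∩ {x : E3 | ⟪p'.1, x⟫ = p'.2}) ∧
      (∀ (K : Fin n → Set E3) (R r : ℝ), 0 < r → (∀ f, K f ⊆ Metric.closedBall 0 R) →
        ∀ f, ∀ a' ∈ S f, ∀ q ∈ polytope (H a'), ∀ w ∈ K f,
        q + r • w ∈ Rungs.box a b →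
        q + r • w ∉ (⋃ g, ⋃ j ∈ S g, polytope (H j)) →
        (∀ p ∈ 𝓗, ⟪p.1, q + r • w⟫ ≠ p.2) →
        (∃ t ∈ Adj, gr t.1 = f ∧ q + r • w ∈ polytope (H t.2) ∧
          (q₀ t).2 - r * sSup ((fun y => ⟪y, -(q₀ t).1⟫) '' K f) < ⟪(q₀ t).1, q + r • w⟫) ∨
        (∃ p ∈ 𝓗, ∃ p' ∈ 𝓗, {x : E3 | ⟪p.1, x⟫ = p.2} ≠ {x : E3 | ⟪p'.1, x⟫ = p'.2} ∧
          |⟪p.1, q + r • w⟫ - p.2| ≤ r * R ∧ |⟪p'.1, q + r • w⟫ - p'.2| ≤ r * R)) := by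
  classical
  choose kf Hf hGf using hPoly
  -- boundedness of the texture and the box with margin `M + 1`
  have hbdG : ∀ f, Bornology.IsBounded (G f) := by
    intro f
    rw [hGf f]
    refine Bornology.isBounded_iUnion.2 fun i => ?_
    have hv : volume (⋃ i, polytope (Hf f i)) < ⊤ := by rw [← hGf f]; exact hvol f
    exact isBounded_piece_of_volume_iUnion_lt_top (Hf f) hv i
  obtain ⟨R₀, hR₀⟩ := (Bornology.isBounded_iUnion.2 hbdG).subset_closedBall (0 : E3)
  set R' : ℝ := |R₀| + M + 1 with hR'
  set a : E3 := WithLp.toLp 2 (fun _ : Fin 3 => -R') with ha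
  set b : E3 := WithLp.toLp 2 (fun _ : Fin 3 => R') with hb
  have hat : ∀ t, a t = -R' := fun t => rfl
  have hbt : ∀ t, b t = R' := fun t => rfl
  have hR'pos : 0 < R' := by positivity
  have hab : ∀ t, a t < b t := fun t => by rw [hat, hbt]; linarith
  have hcoord : ∀ (z : E3) (t : Fin 3), |z t| ≤ ‖z‖ := by
    intro z t
    rw [EuclideanSpace.norm_eq, ← Real.sqrt_sq_eq_abs]
    refine Real.sqrt_le_sqrt ?_
    have h := Finset.single_le_sum (f := fun j : Fin 3 => ‖z j‖ ^ 2) (fun j _ => sq_nonneg _)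
      (Finset.mem_univ t)
    simpa [Real.norm_eq_abs, sq_abs] using h
  have hmargin : ∀ x ∈ (⋃ f, G f), ∀ y : E3, ‖y‖ ≤ M → x + y ∈ Rungs.box a b := by
    intro x hx y hy t
    have hxn : ‖x‖ ≤ R₀ := mem_closedBall_zero_iff.1 (hR₀ hx)
    have h1 : |(x + y) t| ≤ |R₀| + M := by
      calc |(x + y) t| ≤ ‖x + y‖ := hcoord _ t
        _ ≤ ‖x‖ + ‖y‖ := norm_add_le _ _
        _ ≤ |R₀| + M := by gcongr; exact hxn.trans (le_abs_self _)
    rw [hat, hbt]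
    exact ⟨by linarith [(abs_le.1 h1).1], by linarith [(abs_le.1 h1).2]⟩
  have hEbox : closure (⋃ f, G f) ⊆ Rungs.box a b := by
    intro x hx t
    have hx' : x ∈ Metric.closedBall (0 : E3) R₀ :=
      closure_minimal hR₀ Metric.isClosed_closedBall hx
    have hxn : ‖x‖ ≤ R₀ := mem_closedBall_zero_iff.1 hx'
    have h1 : |x t| ≤ |R₀| := (hcoord x t).trans (hxn.trans (le_abs_self _))
    rw [hat, hbt]
    exact ⟨by linarith [(abs_le.1 h1).1], by linarith [(abs_le.1 h1).2]⟩
  obtain ⟨hbox_open, hbox_bdd⟩ := box_isOpen_isBounded a b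
  set HB : Finset (E3 × ℝ) := (Finset.univ.image (fun t => (Rungs.e t, b t)) ∪
    Finset.univ.image (fun t => (-(Rungs.e t), -(a t)))) with hHB
  have hboxH : polytope HB = Rungs.box a b := (Rungs.box_eq_iInter a b).symm
  have hHBunit : ∀ p ∈ HB, ‖p.1‖ = 1 := by
    intro p hp
    rcases Finset.mem_union.1 hp with h | h
    · obtain ⟨t, -, rfl⟩ := Finset.mem_image.1 h
      simp [Rungs.e, PiLp.norm_single]
    · obtain ⟨t, -, rfl⟩ := Finset.mem_image.1 h
      simp [Rungs.e, PiLp.norm_single, norm_neg]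
  -- normalisation of the pieces
  -- normalisation of the non-degenerate pieces (through g0's lemmas, keeping their terms opaque)
  have hnormal : ∀ Gp : Finset (E3 × ℝ), (∀ p ∈ Gp, p.1 = 0 → 0 < p.2) →
      ∃ N : Finset (E3 × ℝ), (⋂ q ∈ Gp, {x : E3 | ⟪q.1, x⟫ < q.2}) = (⋂ q ∈ N, {x : E3 | ⟪q.1, x⟫ < q.2}) ∧
        ∀ q ∈ N, ‖q.1‖ = 1 := fun Gp h =>
    ⟨_, polytope_eq_polytope_normalize Gp h, fun q hq => norm_fst_eq_one_of_mem_normalize Gp hq⟩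
  set nrm : (f : Fin n) → Fin (kf f) → Finset (E3 × ℝ) := fun f i =>
    if h : (∀ p ∈ Hf f i, p.1 = 0 → 0 < p.2) then (hnormal (Hf f i) h).choose else ∅ with hnrm
  have hnrm_eq : ∀ f i, (∀ p ∈ Hf f i, p.1 = 0 → 0 < p.2) →
      (⋂ q ∈ Hf f i, {x : E3 | ⟪q.1, x⟫ < q.2}) = (⋂ q ∈ nrm f i, {x : E3 | ⟪q.1, x⟫ < q.2}) ∧
        ∀ q ∈ nrm f i, ‖q.1‖ = 1 := by
    intro f i h
    have : nrm f i = (hnormal (Hf f i) h).choose := by simp only [hnrm, dif_pos h]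
    rw [this]
    exact (hnormal (Hf f i) h).choose_spec
  set Pf : Fin n → Finset (Finset (E3 × ℝ)) := fun f =>
    (Finset.univ.filter (fun i => ∀ p ∈ Hf f i, p.1 = 0 → 0 < p.2)).image (fun i => nrm f i)
    with hPf
  set 𝒢all : Finset (Finset (E3 × ℝ)) := Finset.univ.biUnion Pf ∪ {HB} with h𝒢all
  set 𝓗 : Finset (E3 × ℝ) := 𝒢all.biUnion id with h𝓗
  have hUf : ∀ f, (⋃ Gp ∈ Pf f, polytope Gp) = G f := by
    intro f
    apply Subset.antisymm
    · intro x hx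
      rw [mem_iUnion₂] at hx
      obtain ⟨Gp, hGp, hxG⟩ := hx
      obtain ⟨i, hi, rfl⟩ := Finset.mem_image.1 hGp
      have hgi := (Finset.mem_filter.1 hi).2
      rw [hGf f]
      refine mem_iUnion.2 ⟨i, ?_⟩
      show x ∈ ⋂ q ∈ Hf f i, {x : E3 | ⟪q.1, x⟫ < q.2}
      rw [(hnrm_eq f i hgi).1]; exact hxG
    · intro x hx
      rw [hGf f] at hx
      obtain ⟨i, hxi⟩ := mem_iUnion.1 hx
      by_cases hgi : ∀ p ∈ Hf f i, p.1 = 0 → 0 < p.2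
      · refine mem_iUnion₂.2 ⟨nrm f i, Finset.mem_image.2 ⟨i, Finset.mem_filter.2
          ⟨Finset.mem_univ i, hgi⟩, rfl⟩, ?_⟩
        show x ∈ ⋂ q ∈ nrm f i, {x : E3 | ⟪q.1, x⟫ < q.2}
        rw [← (hnrm_eq f i hgi).1]; exact hxi
      · push Not at hgi
        obtain ⟨p, hp, hp1, hp2⟩ := hgi
        have := polytope_eq_empty_of_degenerate (Hf f i) hp hp1 hp2
        exact absurd (this ▸ hxi : x ∈ (∅ : Set E3)) (notMem_empty x)
  have hUall : (⋃ Gp ∈ 𝒢all, ⋂ p ∈ Gp, {x : E3 | ⟪p.1, x⟫ < p.2}) = Rungs.box a b := by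
    show (⋃ Gp ∈ Finset.univ.biUnion Pf ∪ {HB}, polytope Gp) = Rungs.box a b
    rw [Finset.set_biUnion_union, Finset.set_biUnion_biUnion, Finset.set_biUnion_singleton, hboxH]
    refine union_eq_right.2 ?_
    intro x hx
    rw [mem_iUnion₂] at hx
    obtain ⟨f, -, hxf⟩ := hx
    rw [hUf f] at hxf
    exact hEbox (subset_closure (mem_iUnion.2 ⟨f, hxf⟩))
  have h1 : ∀ p ∈ 𝓗, ‖p.1‖ = 1 := by
    intro p hp
    obtain ⟨Gp, hGp, hpG⟩ := Finset.mem_biUnion.1 hp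
    rcases Finset.mem_union.1 hGp with h | h
    · obtain ⟨f, -, hf⟩ := Finset.mem_biUnion.1 h
      obtain ⟨i, hi, rfl⟩ := Finset.mem_image.1 hf
      exact (hnrm_eq f i (Finset.mem_filter.1 hi).2).2 p hpG
    · rw [Finset.mem_singleton] at h; subst h
      exact hHBunit p hpG
  have h𝒢sub : ∀ Gp ∈ 𝒢all, Gp ⊆ 𝓗 := fun Gp hGp => Finset.subset_biUnion_of_mem id hGp
  have hPf_sub : ∀ f, Pf f ⊆ 𝒢all := fun f =>
    (Finset.subset_biUnion_of_mem Pf (Finset.mem_univ f)).trans Finset.subset_union_left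
  have hbdd : ∀ Gp ∈ 𝒢all, Bornology.IsBounded (⋂ p ∈ Gp, {x : E3 | ⟪p.1, x⟫ < p.2}) := by
    intro Gp hGp
    refine hbox_bdd.subset ?_
    rw [← hUall]
    exact subset_iUnion₂ (s := fun Gp (_ : Gp ∈ 𝒢all) => ⋂ p ∈ Gp, {x : E3 | ⟪p.1, x⟫ < p.2}) Gp hGp
  have hGrdisj : ∀ f g, f ≠ g → Disjoint (⋃ Gp ∈ Pf f, ⋂ p ∈ Gp, {x : E3 | ⟪p.1, x⟫ < p.2})
      (⋃ Gp ∈ Pf g, ⋂ p ∈ Gp, {x : E3 | ⟪p.1, x⟫ < p.2}) := by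
    intro f g hfg
    have hf := hUf f; have hg := hUf g
    simp only [polytope] at hf hg
    rw [hf, hg]; exact hdisjG f g hfg
  -- the generic package
  obtain ⟨k, H, ν, S, gr, Adj, q₀, hne, hbd, hunit, hdist, hdisj, hanti, hplane, hinside, hae, -, hSmem,
    hS11, hgrS, hAdj13, hAdj14, hcover⟩ :=
    exists_minkowski_package (E := E3) 𝓗 h1 𝒢all h𝒢sub hbdd hn Pf hPf_sub hGrdisj
  rw [hUall] at hinside hae hcover
  refine ⟨𝓗, a, b, k, H, ν, S, gr, Adj, q₀, h1, hab, hmargin, hEbox, hne, hbd, hunit, hdist, hdisj, hanti,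
    hplane, hinside, hae, ?_, ?_, hgrS, ?_, hAdj13, hAdj14, hcover⟩
  · -- cells of `S f` lie in `G f`
    intro f j hj
    obtain ⟨Gp, hGp, hjG⟩ := (hSmem f j).1 hj
    have hf := hUf f
    simp only [polytope] at hf
    rw [← hf]
    exact hjG.trans (subset_iUnion₂ (s := fun Gp (_ : Gp ∈ Pf f) => ⋂ p ∈ Gp, {x : E3 | ⟪p.1, x⟫ < p.2}) Gp hGp)
  · intro f x hoff hx
    have hf := hUf f
    simp only [polytope] at hf
    rw [← hf] at hx
    exact hS11 f x hoff hx
  · intro f g hfg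
    rw [Finset.disjoint_left]
    intro j hjf hjg
    exact hfg ((hgrS f j hjf).symm.trans (hgrS g j hjg))

end Summit.Ventures.Crystal3D.Theorems

end
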